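import Summits.Ventures.PercRepro.Night2OneFatFaces
import Summits.Ventures.PercRepro.Night2LocalRuleGood

/-!
# PercRepro — the cell `(2, 1)`: a good target has at most one coloop and keeps `cap2 ≥ 23/72` (night-2, gen 29)

For a lossy big covering set `Q` of the cell `(2, 1)` (`Night2OneFatFaces`: three coloops `w₁, w₂, w₃` off `K`, the three
thin faces `Q ∖ w_i` with closures `H_i`) and a point `x ∈ G ∖ Q`, the coloops of `(Q ∪ {x}) ∖ K` are the `w_i` with
`x ∈ H_i` (`x` itself lies in `cl (Q ∖ K)`, which spans `V`; a coloop `w` of `(Q ∪ {x}) ∖ K` is a coloop of `Q ∖ K` and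
`x ∈ cl ((Q ∖ K) ∖ w)`, else `cl` of that set would be all of `V ∋ w`).  A GOOD point lies in the closure of at most one
thin face, so a good target has at most one coloop off `K`, at most one thin covering preimage, `L1 ≤ 7/24` and
`cap2 ≥ 11/18 − 7/24 = 23/72`.

* `rkN_sdiff_coloops_eq_five`: `rk (G ∖ K) = 5`; `mem_clF_sdiff_coloops_of_rkN_eq_five`: `V ⊆ cl X` for `X ⊆ V` of rank `5`;
* **`coloops_insert_subset_filter`**: the coloops of `(Q ∪ {x}) ∖ K` inject into the coloops `w` of `Q ∖ K` with
  `x ∈ cl (Q ∖ w)`;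
* **`card_coloops_le_one_of_mem_goodPts`**: at most one coloop at a good target;
* `L1_le_of_card_coloops_le_one`: `L1 S ≤ 7/24`; **`cap2_ge_of_mem_goodPts`**: `cap2 S ≥ 23/72` at a good target.
-/

namespace PercRepro.Shadow

open Finset PerFlat ThmH

variable {α : Type*} [DecidableEq α] {M : Matroid α} [M.Finite] {G : Finset α}

section Targets

/-- `rk (G ∖ K) = 5` in the cell with one coloop. -/
theorem rkN_sdiff_coloops_eq_five (hG : G ∈ flatsQ M (5 + 1)) (hk : kColoops M G = 1) :
    rkN M (G \ coloops M G) = 5 := by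
  have hGg : G ⊆ gr M := (mem_flatsQ.1 hG).1
  have h6 : rkN M G = 6 := by
    have h := (mem_flatsQ.1 hG).2.2
    rw [eRk_eq_rkN] at h
    exact_mod_cast h
  have h := rkN_sdiff_add_card_of_subset_coloops hGg (Finset.Subset.refl (coloops M G))
  rw [h6, ← kColoops_eq_card_coloops, hk] at h
  omega

/-- A subset `X ⊆ G ∖ K` of rank `5` spans `G ∖ K`: every point of `G ∖ K` lies in `cl X`. -/
theorem mem_clF_sdiff_coloops_of_rkN_eq_five (hG : G ∈ flatsQ M (5 + 1)) (hk : kColoops M G = 1)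
    {X : Finset α} (hX : X ⊆ G \ coloops M G) (hr : rkN M X = 5) {x : α} (hx : x ∈ G \ coloops M G) :
    x ∈ clF M X := by
  have hGg : G ⊆ gr M := (mem_flatsQ.1 hG).1
  by_contra hcl
  have h1 := rkN_insert_of_notMem_clF (M := M) (hGg (Finset.mem_sdiff.1 hx).1) hcl
  have h2 : rkN M (insert x X) ≤ rkN M (G \ coloops M G) :=
    rkN_mono (Finset.insert_subset hx hX)
  rw [rkN_sdiff_coloops_eq_five hG hk] at h2
  omega

open scoped Classical in
/-- **The coloops of `(Q ∪ {x}) ∖ K` are coloops `w` of `Q ∖ K` with `x ∈ cl (Q ∖ w)`** (`Q ⊆ G`, `x ∈ G ∖ K`,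
`rk (Q ∖ K) = 5`). -/
theorem coloops_insert_subset_filter (hG : G ∈ flatsQ M (5 + 1)) (hk : kColoops M G = 1) {Q : Finset α}
    (hQG : Q ⊆ G) (hQ5 : rkN M (Q \ coloops M G) = 5) {x : α} (hx : x ∈ G \ coloops M G) (hxQ : x ∉ Q) :
    coloops M (insert x Q \ coloops M G) ⊆
      (coloops M (Q \ coloops M G)).filter (fun w => x ∈ clF M (Q.erase w)) := by
  intro w hw
  have hxK : x ∉ coloops M G := (Finset.mem_sdiff.1 hx).2
  have hGg : G ⊆ gr M := (mem_flatsQ.1 hG).1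
  have hQKV : Q \ coloops M G ⊆ G \ coloops M G := Finset.sdiff_subset_sdiff hQG (Finset.Subset.refl _)
  have hxQK : x ∉ Q \ coloops M G := fun h => hxQ (Finset.mem_sdiff.1 h).1
  have hxcl : x ∈ clF M (Q \ coloops M G) := mem_clF_sdiff_coloops_of_rkN_eq_five hG hk hQKV hQ5 hx
  have hS : insert x Q \ coloops M G = insert x (Q \ coloops M G) := Finset.insert_sdiff_of_notMem _ hxK
  rw [hS, mem_coloops] at hw
  obtain ⟨hwS, hwcl⟩ := hw
  have hwx : w ≠ x := by
    rintro rfl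
    apply hwcl
    rw [Finset.erase_insert hxQK]
    exact hxcl
  have hwQ : w ∈ Q \ coloops M G := by
    rw [Finset.mem_insert] at hwS
    rcases hwS with h | h
    · exact absurd h hwx
    · exact h
  -- `w` is a coloop of `Q ∖ K`
  have hwc : w ∈ coloops M (Q \ coloops M G) := by
    rw [mem_coloops]
    refine ⟨hwQ, fun h => hwcl ?_⟩
    refine clF_mono ?_ h
    intro a ha
    rw [Finset.mem_erase] at ha ⊢
    exact ⟨ha.1, Finset.mem_insert_of_mem ha.2⟩
  rw [Finset.mem_filter]
  refine ⟨hwc, ?_⟩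
  -- `x ∈ cl ((Q ∖ K) ∖ w)`: otherwise that set with `x` has rank `5` and spans `V ∋ w`
  have hxcl' : x ∈ clF M ((Q \ coloops M G).erase w) := by
    by_contra hxn
    apply hwcl
    have hsub : (Q \ coloops M G).erase w ⊆ G \ coloops M G :=
      (Finset.erase_subset _ _).trans hQKV
    have hr1 := rkN_insert_of_notMem_clF (M := M) (hGg (Finset.mem_sdiff.1 hx).1) hxn
    -- `rk ((Q ∖ K) ∖ w) = 4`
    have hr4 : rkN M ((Q \ coloops M G).erase w) = 4 := by
      have h := rkN_erase_of_mem_coloops (M := M) (hQKV.trans (Finset.sdiff_subset.trans hGg)) hwc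
      omega
    have hr5 : rkN M (insert x ((Q \ coloops M G).erase w)) = 5 := by omega
    have hmem : w ∈ clF M (insert x ((Q \ coloops M G).erase w)) :=
      mem_clF_sdiff_coloops_of_rkN_eq_five hG hk (Finset.insert_subset hx hsub) hr5 (hQKV hwQ)
    have heq : (insert x (Q \ coloops M G)).erase w = insert x ((Q \ coloops M G).erase w) := by
      rw [Finset.erase_insert_of_ne hwx.symm]
    rw [heq]
    exact hmem
  refine clF_mono ?_ hxcl'
  intro a ha
  rw [Finset.mem_erase, Finset.mem_sdiff] at ha
  exact Finset.mem_erase.2 ⟨ha.1, ha.2.1⟩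

open scoped Classical in
/-- **A GOOD TARGET HAS AT MOST ONE COLOOP OFF `K`** (cell `(2, 1)`, a lossy big pair `(B, z)`, `x` a good point of
`B ∪ {z}`). -/
theorem card_coloops_le_one_of_mem_goodPts (hG : G ∈ flatsQ M (5 + 1)) (hd : (gr M \ G).card = 2)
    (hk : kColoops M G = 1) (hs : ∀ e ∈ gr M, ∀ f ∈ gr M, e ≠ f → rkN M {e, f} = 2)
    (hl : ∀ e ∈ gr M, M.Indep {e}) {B : Finset α} (hB : B ∈ thinMembers M 5 G)
    (hbig : 5 ≤ (B \ coloops M G).card) {z : α} (hz : z ∈ G \ clF M B) (hl0 : loss M 5 G B z ≠ 0)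
    {x : α} (hx : x ∈ gtPts M 5 G (insert z B)) :
    (coloops M (insert x (insert z B) \ coloops M G)).card ≤ 1 := by
  have hd' : (gr M \ G).card ≤ 5 := by omega
  obtain ⟨-, hImg, -, -⟩ := three_thin_faces_of_loss_ne_zero hG hd hk hs hl hB hbig hz hl0
  set Q := insert z B with hQ
  have hB' : B ∈ membersIn M (Uq M (5 + 2) 5) G := (mem_thinMembers.1 hB).1
  have hBU : B ∈ Uq M (5 + 2) 5 := (mem_membersIn.1 hB').1
  have hBG : B ⊆ G := (subset_clF hBU).trans (mem_membersIn.1 hB').2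
  have hQG : Q ⊆ G := Finset.insert_subset (Finset.mem_sdiff.1 hz).1 hBG
  have hQ5 : rkN M (Q \ coloops M G) = 5 := rkN_insert_sdiff_coloops_eq_five_of_thin hG hd hk hB hz
  have hxG : x ∈ G \ Q := (mem_goodPts.1 hx).1
  have hxQ : x ∉ Q := (Finset.mem_sdiff.1 hxG).2
  have hxK : x ∈ G \ coloops M G := by
    refine Finset.mem_sdiff.2 ⟨(Finset.mem_sdiff.1 hxG).1, fun hxK => hxQ ?_⟩
    exact Finset.mem_insert_of_mem (coloops_subset_of_mem_thinMembers hG hd' hB hxK)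
  have hsub := coloops_insert_subset_filter hG hk hQG hQ5 hxK hxQ
  -- the coloops with `x ∈ cl (Q ∖ w)` inject into the thin faces of `Q` containing `x` in their closure
  have hcnt := (mem_goodPts.1 hx).2
  unfold thinFacesOf at hcnt
  rw [hImg] at hcnt
  have himg : ((coloops M (Q \ coloops M G)).filter (fun w => x ∈ clF M (Q.erase w))).image (fun w => Q.erase w) ⊆
      ((coloops M (Q \ coloops M G)).image (fun w => Q.erase w)).filter (fun F => x ∈ clF M F) := by
    intro F hF
    rw [Finset.mem_image] at hF
    obtain ⟨w, hw, rfl⟩ := hF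
    rw [Finset.mem_filter] at hw
    exact Finset.mem_filter.2 ⟨Finset.mem_image.2 ⟨w, hw.1, rfl⟩, hw.2⟩
  have hinj : Set.InjOn (fun w => Q.erase w)
      ↑((coloops M (Q \ coloops M G)).filter (fun w => x ∈ clF M (Q.erase w))) := by
    intro w₁ hw₁ w₂ hw₂ h
    rw [Finset.mem_coe, Finset.mem_filter] at hw₁ hw₂
    exact erase_injOn Q (Finset.mem_sdiff.1 (mem_coloops.1 hw₁.1).1).1
      (Finset.mem_sdiff.1 (mem_coloops.1 hw₂.1).1).1 h
  calc (coloops M (insert x Q \ coloops M G)).card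
      ≤ ((coloops M (Q \ coloops M G)).filter (fun w => x ∈ clF M (Q.erase w))).card := Finset.card_le_card hsub
    _ = (((coloops M (Q \ coloops M G)).filter (fun w => x ∈ clF M (Q.erase w))).image
          (fun w => Q.erase w)).card := (Finset.card_image_of_injOn hinj).symm
    _ ≤ (((coloops M (Q \ coloops M G)).image (fun w => Q.erase w)).filter (fun F => x ∈ clF M F)).card :=
          Finset.card_le_card himg
    _ ≤ 1 := hcnt

open scoped Classical in
/-- `L1 S ≤ 7/24` when `S ∖ K` has at most one coloop (`S ⊆ G`). -/
theorem L1_le_of_card_coloops_le_one (hG : G ∈ flatsQ M (5 + 1)) (hd : (gr M \ G).card = 2) {S : Finset α}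
    (hc : (coloops M (S \ coloops M G)).card ≤ 1) : L1 M 5 G S ≤ 7 / 24 := by
  have hd' : (gr M \ G).card ≤ 5 := by omega
  set Pre := (coverPreimages M (Uq M (5 + 2) 5) G S).filter (fun F => F ∉ lay0 M 5 G) with hPre
  have hthin : ∀ F ∈ Pre, F ∈ thinMembers M 5 G := by
    intro F hF
    rw [hPre, Finset.mem_filter, mem_coverPreimages] at hF
    exact mem_thinMembers.2 ⟨hF.1.1, hF.2⟩
  have hPre1 : Pre.card ≤ 1 :=
    (Finset.card_le_card (thin_coverPreimages_subset_image_coloops hG hd' S)).trans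
      (Finset.card_image_le.trans hc)
  have hL1 : L1 M 5 G S ≤ (Pre.card : ℚ) * (7 / 24) := by
    unfold L1
    rw [← hPre]
    calc ∑ F ∈ Pre, req M 5 F ≤ ∑ _F ∈ Pre, (7 / 24 : ℚ) :=
          Finset.sum_le_sum (fun F hF => req_le_of_thin_two_one hG hd (hthin F hF))
      _ = (Pre.card : ℚ) * (7 / 24) := by rw [Finset.sum_const, nsmul_eq_mul]
  have hc1 : (Pre.card : ℚ) ≤ 1 := by exact_mod_cast hPre1
  nlinarith

open scoped Classical in
/-- **A GOOD TARGET KEEPS `cap2 ≥ 23/72`** (cell `(2, 1)`). -/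
theorem cap2_ge_of_mem_goodPts (hG : G ∈ flatsQ M (5 + 1)) (hd : (gr M \ G).card = 2)
    (hk : kColoops M G = 1) (hs : ∀ e ∈ gr M, ∀ f ∈ gr M, e ≠ f → rkN M {e, f} = 2)
    (hl : ∀ e ∈ gr M, M.Indep {e}) {B : Finset α} (hB : B ∈ thinMembers M 5 G)
    (hbig : 5 ≤ (B \ coloops M G).card) {z : α} (hz : z ∈ G \ clF M B) (hl0 : loss M 5 G B z ≠ 0)
    {x : α} (hx : x ∈ gtPts M 5 G (insert z B)) :
    (23 / 72 : ℚ) ≤ cap2 M 5 G (insert x (insert z B)) := by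
  have hd' : (gr M \ G).card ≤ 5 := by omega
  have hc := card_coloops_le_one_of_mem_goodPts hG hd hk hs hl hB hbig hz hl0 hx
  have hL1 := L1_le_of_card_coloops_le_one hG hd hc
  have hSG : insert x (insert z B) ⊆ G := by
    have hB' : B ∈ membersIn M (Uq M (5 + 2) 5) G := (mem_thinMembers.1 hB).1
    have hBG : B ⊆ G := (subset_clF (mem_membersIn.1 hB').1).trans (mem_membersIn.1 hB').2
    exact Finset.insert_subset (Finset.mem_sdiff.1 (mem_goodPts.1 hx).1).1
      (Finset.insert_subset (Finset.mem_sdiff.1 hz).1 hBG)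
  have hcap := capS_ge_eleven_eighteenths_two_one hd hk hSG
  have h := cap2_ge_capS_sub_L1_of_le hG hd' (insert x (insert z B))
  linarith

end Targets

end PercRepro.Shadow
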